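import Summits.AnomalousDissipation.AnomalousDissipation.Theorems.UniformResolution.Negative.ResolutionCriterion
import Summits.AnomalousDissipation.AnomalousDissipation.Theorems.MomentParityMomentClosureCarrier

/-!
# `MomentParity.ResolvedDissipation` (stmt-AnomalousDissipation-14284), line `enstrophy-ui-transfer`:
# the CONVERSE of the transfer — a common resolution schedule forces uniform integrability of the enstrophy

Supports stmt-AnomalousDissipation-14284 (helper of the line lead; nothing here closes an item).

The line reduces the crux `ResolvedDissipation` (RD) to the `N`-uniform UNIFORM INTEGRABILITY (UI) of the
enstrophy `‖∇u‖²` over the admissible family of Galerkin-invariant laws in a ball (hard stub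
`stub_uniformIntegrability`), via the landed resolution criterion
`Theorems/UniformResolution/Negative/ResolutionCriterion.lean`. This file certifies the converse direction, so that
RD ⟺ UI is a theorem of the tree and the disprover's kill shape for the line reads "exhibit a non-UI invariant family":

* `eGradNormSq_fourierTruncate_le_norm` — Bernstein for truncations on `H`:
  `‖∇P_K u‖² ≤ 4π²K² ‖u‖²` (in `ℝ≥0∞`).
* `uniformlyIntegrableEnstrophy_of_resolved` — for ANY family of finite laws on `H` supported in a common ball
  `‖u‖ ≤ R`, ONE schedule `κ` with `∫‖∇u‖² ≤ ∫‖∇P_{κ n}u‖² + 1/(n+1)` (all `n`, all laws) gives UI: on `{‖∇u‖² > M}`,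
  `M = 2·4π²κ(n)²R²`, the tail `‖∇u‖² − ‖∇P_{κ n}u‖²` is at least half of `‖∇u‖²`, so
  `∫_{‖∇u‖²>M} ‖∇u‖² ≤ 2∫ tail ≤ 2/(n+1)`.
* `uniformlyIntegrableEnstrophy_of_resolvedDissipation` — specialisation to the crux: `ResolvedDissipation` implies the
  hard stub's statement verbatim (UI of the admissible family at every `(f, ν, R)`).
-/

noncomputable section

-- `Summit.<Summit>.<Problem>`: single-conjunct summit, the duplicate namespace segment is mandated.
set_option linter.dupNamespace false

namespace Summit.AnomalousDissipation.AnomalousDissipation.Theorems.MomentParityResolvedDissipation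

open MeasureTheory Filter Topology
open scoped ENNReal InnerProductSpace RealInnerProductSpace
open Literature.Analysis.FunctionSpaces Literature.Analysis.FluidPDE
open Summit.AnomalousDissipation.AnomalousDissipation.Theses.MomentParity
open Summit.AnomalousDissipation.AnomalousDissipation.Theorems.CubicParityLoud.Negative (T3 R3 H3 L2T3)
open Summit.AnomalousDissipation.AnomalousDissipation.Theorems.QuarticGate.Negative
  (IsLevel IsBandTest polyGrad IsPolyStationary)
open Summit.AnomalousDissipation.AnomalousDissipation.Theorems.UniformResolution.Negative
  (UniformlyIntegrableEnstrophy eGradNormSq_eq_fourierTruncate_add_tail measurable_tailGradNormSq_coe)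

/-- **Bernstein for truncations on `H`**: `‖∇P_K u‖₂² ≤ 4π²K² ‖u‖²` for every `u ∈ H` (in `ℝ≥0∞`):
the truncated enstrophy is the band sum `4π² Σ_{|k|≤K} |k|²‖û(k)‖²`, `|k|² ≤ K²` on the ball, and Bessel.
[folklore] -/
theorem eGradNormSq_fourierTruncate_le_norm (K : ℕ) (u : H3) :
    Torus.eGradNormSq (Torus.fourierTruncate K (u.1 : T3 → R3)) ≤
      ENNReal.ofReal (4 * Real.pi ^ 2 * (K : ℝ) ^ 2 * ‖u‖ ^ 2) := by
  rw [MomentParityMomentClosure.eGradNormSq_fourierTruncate_coe]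
  refine ENNReal.ofReal_le_ofReal ?_
  have hint : Integrable (u.1 : T3 → R3) volume := (Lp.memLp u.1).integrable one_le_two
  have h1 : ∑ k ∈ Torus.freqBall K, Torus.freqNormSq k *
      ‖UnitAddTorus.mFourierCoeff (EuclideanSpace.complexify ∘ (u.1 : T3 → R3)) k‖ ^ 2 ≤
      (K : ℝ) ^ 2 * ∑ k ∈ Torus.freqBall K,
        ‖UnitAddTorus.mFourierCoeff (EuclideanSpace.complexify ∘ (u.1 : T3 → R3)) k‖ ^ 2 := by
    rw [Finset.mul_sum]
    exact Finset.sum_le_sum fun k hk =>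
      mul_le_mul_of_nonneg_right (Torus.mem_freqBall.1 hk) (sq_nonneg _)
  have h2 : ∑ k ∈ Torus.freqBall K,
      ‖UnitAddTorus.mFourierCoeff (EuclideanSpace.complexify ∘ (u.1 : T3 → R3)) k‖ ^ 2 ≤ ‖u‖ ^ 2 := by
    rw [← Torus.integral_norm_sq_fourierTruncate hint K]
    have h := Torus.integral_norm_sq_fourierTruncate_le (Lp.memLp u.1) K
    have e : ∫ x, ‖(u.1 : T3 → R3) x‖ ^ 2 = ‖u‖ ^ 2 := Torus.integral_norm_sq_coe_eq u.1
    linarith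
  have hpi : 0 ≤ 4 * Real.pi ^ 2 := by positivity
  calc 4 * Real.pi ^ 2 * ∑ k ∈ Torus.freqBall K, Torus.freqNormSq k *
        ‖UnitAddTorus.mFourierCoeff (EuclideanSpace.complexify ∘ (u.1 : T3 → R3)) k‖ ^ 2
      ≤ 4 * Real.pi ^ 2 * ((K : ℝ) ^ 2 * ‖u‖ ^ 2) := by
        refine mul_le_mul_of_nonneg_left (h1.trans ?_) hpi
        exact mul_le_mul_of_nonneg_left h2 (sq_nonneg _)
    _ = 4 * Real.pi ^ 2 * (K : ℝ) ^ 2 * ‖u‖ ^ 2 := by ring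

/-- **RD ⇒ UI — a common resolution schedule forces uniform integrability of the enstrophy.** Let `𝓕` be a
family of finite Borel laws on `H` supported in a common ball `‖u‖ ≤ R`, and let ONE schedule `κ : ℕ → ℕ`
resolve the mean enstrophy of every law of the family: `∫‖∇u‖² dμ ≤ ∫‖∇P_{κ n}u‖² dμ + 1/(n+1)` for all `n`
and all `μ ∈ 𝓕` (the conclusion of `ResolvedDissipation`). Then the enstrophy is uniformly integrable over `𝓕`
(`UniformlyIntegrableEnstrophy 𝓕`): given `η > 0` take `n` with `2/(n+1) ≤ η` and
`M = 2·4π²κ(n)²R²`; on `{‖∇u‖² > M}` Bernstein gives `‖∇P_{κ n}u‖² ≤ M/2 < ‖∇u‖²/2`, so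
`‖∇u‖² ≤ 2(‖∇u‖² − ‖∇P_{κ n}u‖²)` there, and `∫_{‖∇u‖²>M}‖∇u‖² ≤ 2∫(‖∇u‖² − ‖∇P_{κ n}u‖²) ≤ 2/(n+1) ≤ η`.
This is the converse of the line's transfer (UI + weighted `H²` bound ⇒ one schedule), so the hard stub of line
`enstrophy-ui-transfer` is EQUIVALENT to the crux. [folklore] -/
theorem uniformlyIntegrableEnstrophy_of_resolved {𝓕 : Set (Measure H3)} {R : ℝ} {κ : ℕ → ℕ}
    (hfin : ∀ μ ∈ 𝓕, IsFiniteMeasure μ) (hball : ∀ μ ∈ 𝓕, ∀ᵐ u ∂μ, ‖u‖ ≤ R)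
    (hres : ∀ μ ∈ 𝓕, ∀ n : ℕ,
      ∫⁻ u, Torus.eGradNormSq (u.1 : T3 → R3) ∂μ ≤
        (∫⁻ u, Torus.eGradNormSq (Torus.fourierTruncate (κ n) (u.1 : T3 → R3)) ∂μ) + ((n : ℝ≥0∞) + 1)⁻¹) :
    UniformlyIntegrableEnstrophy 𝓕 := by
  intro η hη
  -- choose the tolerance `2/(n+1) ≤ η`
  obtain ⟨n, hn⟩ := ENNReal.exists_inv_nat_lt (a := η / 2) (ENNReal.div_pos hη.ne' ENNReal.ofNat_ne_top).ne'
  set K : ℕ := κ n with hK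
  -- the Bernstein ceiling of the truncated enstrophy on the ball, and the threshold `M = 2B`
  set B : ℝ≥0∞ := ENNReal.ofReal (4 * Real.pi ^ 2 * (K : ℝ) ^ 2 * R ^ 2) with hB
  refine ⟨2 * B, ENNReal.mul_ne_top ENNReal.ofNat_ne_top ENNReal.ofReal_ne_top, fun μ hμ => ?_⟩
  haveI := hfin μ hμ
  -- abbreviations
  set Z : H3 → ℝ≥0∞ := fun u => Torus.eGradNormSq (u.1 : T3 → R3) with hZ
  set ZP : H3 → ℝ≥0∞ := fun u => Torus.eGradNormSq (Torus.fourierTruncate K (u.1 : T3 → R3)) with hZP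
  set tl : H3 → ℝ≥0∞ := fun u => Torus.tailGradNormSq K (u.1 : T3 → R3) with htl
  have hsplit : ∀ u : H3, Z u = ZP u + tl u := fun u =>
    eGradNormSq_eq_fourierTruncate_add_tail ((Lp.memLp u.1).integrable one_le_two) K
  have htlm : Measurable tl := measurable_tailGradNormSq_coe K
  -- a.e. Bernstein: `ZP ≤ B`
  have hZPB : ∀ᵐ u ∂μ, ZP u ≤ B := by
    filter_upwards [hball μ hμ] with u hu
    refine (eGradNormSq_fourierTruncate_le_norm K u).trans (ENNReal.ofReal_le_ofReal ?_)
    have h0 : 0 ≤ ‖u‖ := norm_nonneg u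
    have h2 : ‖u‖ ^ 2 ≤ R ^ 2 := by nlinarith
    exact mul_le_mul_of_nonneg_left h2 (by positivity)
  -- on `{Z > 2B}` the tail dominates half the enstrophy: `Z ≤ 2 tl`
  set S : Set H3 := {u : H3 | 2 * B < Z u} with hS_def
  have hS : MeasurableSet S := measurableSet_lt measurable_const Torus.measurable_eGradNormSq_coe
  have hpt : ∀ᵐ u ∂μ, S.indicator Z u ≤ 2 * tl u := by
    filter_upwards [hZPB] with u hu
    by_cases hmem : u ∈ S
    · rw [Set.indicator_of_mem hmem]
      have hlt : 2 * B < Z u := hmem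
      have hZPtop : ZP u ≠ ⊤ := ne_top_of_le_ne_top ENNReal.ofReal_ne_top hu
      have h1 : ZP u + ZP u < ZP u + tl u := by
        calc ZP u + ZP u ≤ B + B := add_le_add hu hu
          _ = 2 * B := (two_mul B).symm
          _ < Z u := hlt
          _ = ZP u + tl u := hsplit u
      have h2 : ZP u < tl u := (ENNReal.add_lt_add_iff_left hZPtop).1 h1
      calc Z u = ZP u + tl u := hsplit u
        _ ≤ tl u + tl u := add_le_add h2.le le_rfl
        _ = 2 * tl u := (two_mul _).symm
    · rw [Set.indicator_of_notMem hmem]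
      exact zero_le
  -- the mean tail is at most the tolerance `1/(n+1)`
  have hZPint : ∫⁻ u, ZP u ∂μ ≠ ⊤ := by
    have h1 : ∫⁻ u, ZP u ∂μ ≤ ∫⁻ _u, B ∂μ := lintegral_mono_ae hZPB
    rw [lintegral_const] at h1
    exact ne_top_of_le_ne_top (ENNReal.mul_ne_top ENNReal.ofReal_ne_top (measure_ne_top μ _)) h1
  have htail : ∫⁻ u, tl u ∂μ ≤ ((n : ℝ≥0∞) + 1)⁻¹ := by
    have h1 : ∫⁻ u, Z u ∂μ = (∫⁻ u, ZP u ∂μ) + ∫⁻ u, tl u ∂μ := by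
      rw [← lintegral_add_right _ htlm]
      exact lintegral_congr fun u => hsplit u
    have h2 := hres μ hμ n
    rw [h1] at h2
    exact (ENNReal.add_le_add_iff_left hZPint).1 h2
  -- integrate
  calc ∫⁻ u in S, Z u ∂μ = ∫⁻ u, S.indicator Z u ∂μ := (lintegral_indicator hS _).symm
    _ ≤ ∫⁻ u, 2 * tl u ∂μ := lintegral_mono_ae hpt
    _ = 2 * ∫⁻ u, tl u ∂μ := lintegral_const_mul _ htlm
    _ ≤ 2 * ((n : ℝ≥0∞) + 1)⁻¹ := by gcongr
    _ ≤ 2 * (n : ℝ≥0∞)⁻¹ := by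
        gcongr
        exact le_self_add
    _ ≤ 2 * (η / 2) := by gcongr
    _ = η := ENNReal.mul_div_cancel two_ne_zero ENNReal.ofNat_ne_top

/-- **`ResolvedDissipation` implies the hard stub of line `enstrophy-ui-transfer`** (UI of the admissible family at
every `(f, ν, R)`, stated verbatim as in the skeleton's `stub_uniformIntegrability`): the crux's schedule `κ(f, ν, R)`
resolves every admissible law, and admissible laws are probability laws in the ball `‖u‖ ≤ R`, so
`uniformlyIntegrableEnstrophy_of_resolved` applies. Together with the skeleton (`UI ⇒ RD` through the resolution
criterion and the FGT weighted bound) this makes the hard stub EQUIVALENT to the crux. [folklore] -/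
theorem uniformIntegrability_of_resolvedDissipation :
    ResolvedDissipation → ∀ f : UnitAddTorus (Fin 3) → EuclideanSpace ℝ (Fin 3),
      Torus.IsSmooth f → Torus.IsDivFree f → Torus.HasZeroMean f →
      ∀ ν : ℝ, 0 < ν → ∀ R : ℝ, ∀ ε : ℝ≥0∞, 0 < ε → ∃ M : ℝ≥0∞, M ≠ ⊤ ∧
        ∀ (N : ℕ) (μ : Measure (Torus.energySpace (Fin 3))), IsProbabilityMeasure μ →
          (∀ᵐ u ∂μ, IsLevel N u) → (∀ᵐ u ∂μ, ‖u‖ ≤ R) → (∀ d : ℕ, IsPolyStationary ν f N d μ) →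
          ∫⁻ u in {u : Torus.energySpace (Fin 3) |
              M < Torus.eGradNormSq (u.1 : UnitAddTorus (Fin 3) → EuclideanSpace ℝ (Fin 3))},
            Torus.eGradNormSq (u.1 : UnitAddTorus (Fin 3) → EuclideanSpace ℝ (Fin 3)) ∂μ ≤ ε := by
  intro hRD f hf hdiv hzero ν hν R ε hε
  obtain ⟨κ, hκ⟩ := hRD f hf hdiv hzero ν hν R
  have hUI : UniformlyIntegrableEnstrophy {μ : Measure H3 | IsProbabilityMeasure μ ∧ ∃ N : ℕ,
      (∀ᵐ u ∂μ, IsLevel N u) ∧ (∀ᵐ u ∂μ, ‖u‖ ≤ R) ∧ ∀ d : ℕ, IsPolyStationary ν f N d μ} := by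
    refine uniformlyIntegrableEnstrophy_of_resolved (R := R) (κ := κ) (fun μ hμ => ?_) (fun μ hμ => ?_)
      (fun μ hμ n => ?_)
    · haveI := hμ.1; infer_instance
    · obtain ⟨-, N, -, hb, -⟩ := hμ; exact hb
    · obtain ⟨hp, N, hl, hb, hs⟩ := hμ
      exact hκ N μ hp hl hb (fun m g P hg => hs (P.totalDegree + 1) m g P hg le_rfl) n
  obtain ⟨M, hM, hUIM⟩ := hUI ε hε
  exact ⟨M, hM, fun N μ hp hl hb hs => hUIM μ ⟨hp, N, hl, hb, hs⟩⟩

end Summit.AnomalousDissipation.AnomalousDissipation.Theorems.MomentParityResolvedDissipation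

end
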